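import Literature.Analysis.FluidPDE.OnsagerBDSVPerturbation
import Literature.Analysis.FluidPDE.OnsagerBDSVBiotSavart
import Literature.Analysis.FluidPDE.OnsagerBDSVThreeStagesProofs
import HarnessLib

/-!
# The BDSV energy estimate: tools for the cross term (integration by parts of the curl, sup bounds)

Buckmaster–De Lellis–Székelyhidi–Vicol (BDSV), *Onsager's conjecture for admissible weak
solutions*, CPAM 72 (2019) = arXiv:1701.08678. The first estimate in the proof of Prop. 6.2
("By integrating by parts once and using the identity [the curl form (5.28) of `w_{q+1}`] … we
obtain `|∫ w_{q+1}·v̄_q| ≤ …`") rests on elementary facts about fields on `T³` which this file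
PROVES, for use in the discharge of `BDSV.energy_crossTerm` (`OnsagerBDSVEnergy.lean`):

* `BDSV.integral_inner_curl_comm`: `∫_{T³} ⟪curl Z, v⟫ = ∫_{T³} ⟪Z, curl v⟫` for smooth `Z, v`
  (no boundary terms on the torus);
* `BDSV.abs_integral_inner_le`: `|∫ ⟪f, g⟫| ≤ B_f B_g` for fields bounded by `B_f`, `B_g`
  (`T³` has measure one);
* `BDSV.norm_curl_le`: `‖curl v(x)‖ ≤ 6B` if every first partial of `v` is bounded by `B`;
* `BDSV.HolderSupLE.supLE_of_zero`: the bridge `‖f‖₀ ≤ ‖f‖_{0+r}` from a `C^{0,r}` bound to a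
  sup bound (companion of `HolderSupLE.supLE_of_one`);
* `BDSV.CutoffFamily.norm_sum_le`: by the pairwise disjointness (ii) of the squiggling cut-offs,
  a sum `∑_i f_i` of terms with `f_i = 0` wherever `η_i(x,t) = 0` has at most one nonzero term,
  so `‖∑_i f_i‖ ≤ sup_i ‖f_i‖`;
* `BDSV.MikadoDatum.exists_bound_V/W`: a Mikado profile and its potential are bounded on
  `K × T³` for every compact set `K` of matrices (continuity and compactness);
* `BDSV.norm_toEuclideanLin_le`, `BDSV.norm_matrix_mul_le`: `‖Av‖ ≤ 9‖A‖_∞‖v‖`,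
  `‖AB‖_∞ ≤ 3‖A‖_∞‖B‖_∞` for `3 × 3` matrices in the elementwise sup norm.

## References

* T. Buckmaster, C. De Lellis, L. Székelyhidi Jr., V. Vicol, *Onsager's conjecture for admissible
  weak solutions*, Comm. Pure Appl. Math. 72 (2019) 229–274 = arXiv:1701.08678, proof of
  Prop. 6.2 (first estimate) and §5.2 (ii).
* L. C. Evans, *Partial Differential Equations*, 2nd ed., AMS 2010, App. C.2 Thm. 2 (integration
  by parts).
-/

open MeasureTheory Set
open scoped NNReal ENNReal ContDiff InnerProductSpace Matrix Matrix.Norms.Elementwise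

noncomputable section

namespace Literature.Analysis.FluidPDE

namespace BDSV

open FunctionSpaces FunctionSpaces.Torus

/-! ## Integration by parts of the curl -/

section Curl

variable {Z v : UnitAddTorus (Fin 3) → EuclideanSpace ℝ (Fin 3)}

/-- Components commute with partial derivatives: `(∂ⱼ v)ᵢ = ∂ⱼ (vᵢ)` for smooth `v`. [folklore] -/
theorem partialDeriv_apply_eq (hv : IsSmooth v) (j i : Fin 3) (x : UnitAddTorus (Fin 3)) :
    partialDeriv j v x i = partialDeriv j (fun y => v y i) x :=
  (partialDeriv_clm_comp hv (EuclideanSpace.proj i) j x).symm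

/-- Scalar integration by parts on `T³`: `∫ (∂ⱼ f) g = -∫ f ∂ⱼ g` for smooth `f, g`
(Evans, App. C.2 Thm. 2, empty boundary). [cite: Evans2010, App. C.2 Thm. 2] -/
theorem integral_partialDeriv_mul_eq_neg {f g : UnitAddTorus (Fin 3) → ℝ} (hf : IsSmooth f)
    (hg : IsSmooth g) (j : Fin 3) : ∫ x, partialDeriv j f x * g x = -∫ x, f x * partialDeriv j g x := by
  have h := integral_inner_partialDeriv_eq_neg hf hg j
  simp only [RCLike.inner_apply, conj_trivial] at h
  have h1 : (fun x => partialDeriv j f x * g x) = fun x => g x * partialDeriv j f x := by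
    funext x; ring
  have h2 : (fun x => f x * partialDeriv j g x) = fun x => partialDeriv j g x * f x := by
    funext x; ring
  rw [h1, h2]
  exact h

/-- **Integration by parts of the curl on `T³`**: `∫ ⟪curl Z, v⟫ = ∫ ⟪Z, curl v⟫` for smooth
`Z, v` (componentwise `∫ vᵢ ∂ⱼ Z_k = -∫ Z_k ∂ⱼ vᵢ`, no boundary on the torus; the step "by
integrating by parts once" of the proof of BDSV Prop. 6.2). [cite: Evans2010, App. C.2 Thm. 2] -/
theorem integral_inner_curl_comm (hZ : IsSmooth Z) (hv : IsSmooth v) :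
    ∫ x, ⟪curl Z x, v x⟫_ℝ = ∫ x, ⟪Z x, curl v x⟫_ℝ := by
  -- the by-parts identities `I j a b : ∫ (∂ⱼ Zₐ) v_b = -∫ Zₐ ∂ⱼ v_b` for the (smooth, by
  -- `IsSmooth.apply`) scalar components
  have I : ∀ j a b : Fin 3, ∫ x, partialDeriv j Z x a * v x b =
      -∫ x, Z x a * partialDeriv j v x b := by
    intro j a b
    have h := integral_partialDeriv_mul_eq_neg (hZ.apply a) (hv.apply b) j
    have e1 : (fun x => partialDeriv j Z x a * v x b) =
        fun x => partialDeriv j (fun y => Z y a) x * v x b := by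
      funext x; rw [partialDeriv_apply_eq hZ]
    have e2 : (fun x => Z x a * partialDeriv j v x b) =
        fun x => Z x a * partialDeriv j (fun y => v y b) x := by
      funext x; rw [partialDeriv_apply_eq hv]
    rw [e1, e2]
    exact h
  -- integrability of the products
  have hint₁ : ∀ j a b : Fin 3, Integrable fun x => partialDeriv j Z x a * v x b := by
    intro j a b
    have h : IsSmooth fun x => partialDeriv j Z x a * v x b :=
      ((hZ.partialDeriv j).apply a).mul (hv.apply b)
    exact h.integrable
  have hint₂ : ∀ j a b : Fin 3, Integrable fun x => Z x a * partialDeriv j v x b := by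
    intro j a b
    have h : IsSmooth fun x => Z x a * partialDeriv j v x b :=
      (hZ.apply a).mul ((hv.partialDeriv j).apply b)
    exact h.integrable
  -- expand both sides in components
  have lhs : ∀ x, ⟪curl Z x, v x⟫_ℝ =
      (partialDeriv 1 Z x 2 * v x 0 - partialDeriv 2 Z x 1 * v x 0) +
      (partialDeriv 2 Z x 0 * v x 1 - partialDeriv 0 Z x 2 * v x 1) +
      (partialDeriv 0 Z x 1 * v x 2 - partialDeriv 1 Z x 0 * v x 2) := by
    intro x
    rw [EuclideanSpace.inner_eq_star_dotProduct, dotProduct, Fin.sum_univ_three]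
    simp only [star_trivial, curl_apply_zero, curl_apply_one, curl_apply_two]
    ring
  have rhs : ∀ x, ⟪Z x, curl v x⟫_ℝ =
      (Z x 0 * partialDeriv 1 v x 2 - Z x 0 * partialDeriv 2 v x 1) +
      (Z x 1 * partialDeriv 2 v x 0 - Z x 1 * partialDeriv 0 v x 2) +
      (Z x 2 * partialDeriv 0 v x 1 - Z x 2 * partialDeriv 1 v x 0) := by
    intro x
    rw [EuclideanSpace.inner_eq_star_dotProduct, dotProduct, Fin.sum_univ_three]
    simp only [star_trivial, curl_apply_zero, curl_apply_one, curl_apply_two]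
    ring
  simp_rw [lhs, rhs]
  rw [integral_add, integral_add, integral_sub, integral_sub, integral_sub,
    integral_add, integral_add, integral_sub, integral_sub, integral_sub]
  · rw [I 1 2 0, I 2 1 0, I 2 0 1, I 0 2 1, I 0 1 2, I 1 0 2]
    ring
  all_goals first
    | exact hint₂ _ _ _
    | exact hint₁ _ _ _
    | exact (hint₂ _ _ _).sub (hint₂ _ _ _)
    | exact (hint₁ _ _ _).sub (hint₁ _ _ _)
    | exact ((hint₂ _ _ _).sub (hint₂ _ _ _)).add ((hint₂ _ _ _).sub (hint₂ _ _ _))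
    | exact ((hint₁ _ _ _).sub (hint₁ _ _ _)).add ((hint₁ _ _ _).sub (hint₁ _ _ _))

end Curl

/-! ## Sup bounds: integrals of inner products, the curl, `C^{0,r}` norms -/

section SupBounds

/-- The Euclidean norm is bounded by the sum of the coordinates' absolute values (a local copy of
`BDSV.norm_le_sum_abs` of `OnsagerBDSVProofs.lean`, not imported here). [folklore] -/
private theorem norm_le_sum_abs₃ (V : EuclideanSpace ℝ (Fin 3)) : ‖V‖ ≤ ∑ i, |V i| := by
  conv_lhs => rw [← (EuclideanSpace.basisFun (Fin 3) ℝ).sum_repr V]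
  refine (norm_sum_le _ _).trans (Finset.sum_le_sum fun i _ => ?_)
  rw [EuclideanSpace.basisFun_repr, EuclideanSpace.basisFun_apply, norm_smul, Real.norm_eq_abs]
  simp

/-- **Sup bound for the curl**: if every first partial derivative of `v` at `x` has norm at most
`B`, then `‖curl v(x)‖ ≤ 6B` (each component is a difference of two coordinates of partials). [folklore] -/
theorem norm_curl_le {v : UnitAddTorus (Fin 3) → EuclideanSpace ℝ (Fin 3)} {x : UnitAddTorus (Fin 3)}
    {B : ℝ} (hv : ∀ j, ‖partialDeriv j v x‖ ≤ B) :
    ‖curl v x‖ ≤ 6 * B := by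
  have hc : ∀ j i, |partialDeriv j v x i| ≤ B := fun j i =>
    (abs_apply_le_norm _ i).trans (hv j)
  have h0 : |curl v x 0| ≤ 2 * B := by
    rw [curl_apply_zero]
    exact (abs_sub _ _).trans (by linarith [hc 1 2, hc 2 1])
  have h1 : |curl v x 1| ≤ 2 * B := by
    rw [curl_apply_one]
    exact (abs_sub _ _).trans (by linarith [hc 2 0, hc 0 2])
  have h2 : |curl v x 2| ≤ 2 * B := by
    rw [curl_apply_two]
    exact (abs_sub _ _).trans (by linarith [hc 0 1, hc 1 0])
  calc ‖curl v x‖ ≤ ∑ i, |curl v x i| := norm_le_sum_abs₃ _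
    _ = |curl v x 0| + |curl v x 1| + |curl v x 2| := by rw [Fin.sum_univ_three]
    _ ≤ 6 * B := by linarith

/-- **Integrals of inner products of bounded fields** on `T³` (a probability space):
`|∫ ⟪f, g⟫| ≤ B_f B_g` if `‖f‖ ≤ B_f`, `‖g‖ ≤ B_g` pointwise (`B_f ≥ 0`). [folklore] -/
theorem abs_integral_inner_le {f g : UnitAddTorus (Fin 3) → EuclideanSpace ℝ (Fin 3)} {Bf Bg : ℝ}
    (hf : ∀ x, ‖f x‖ ≤ Bf) (hg : ∀ x, ‖g x‖ ≤ Bg) (hBf : 0 ≤ Bf) : |∫ x, ⟪f x, g x⟫_ℝ| ≤ Bf * Bg := by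
  have h : ∀ x, ‖⟪f x, g x⟫_ℝ‖ ≤ Bf * Bg := fun x =>
    (norm_inner_le_norm _ _).trans (mul_le_mul (hf x) (hg x) (norm_nonneg _) hBf)
  have := norm_integral_le_of_norm_le_const (μ := (volume : Measure (UnitAddTorus (Fin 3))))
    (Filter.Eventually.of_forall h)
  rw [Real.norm_eq_abs] at this
  simpa using this

variable {F : Type*} [NormedAddCommGroup F] [NormedSpace ℝ F] {T : ℝ}
  {f : ℝ → UnitAddTorus (Fin 3) → F} {r : ℝ≥0} {B : ℝ}

/-- `‖f‖₀ ≤ ‖f‖_{0+r}`: a bound `‖f(t)‖_{C^{0,r}} ≤ B` (`B ≥ 0`) on `[0,T]` gives `‖f‖₀ ≤ B`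
(companion of `BDSV.HolderSupLE.supLE_of_one`). [folklore] -/
theorem HolderSupLE.supLE_of_zero (h : HolderSupLE T f 0 r B) (hB : 0 ≤ B) : SupLE T f B := by
  intro t ht x
  have h1 : ‖f t x‖ₑ ≤ FunctionSpaces.Torus.eContDiffHolderNorm 0 r (f t) :=
    (FunctionSpaces.enorm_le_eSupNorm (f t) x).trans
      (FunctionSpaces.Torus.eSupNorm_le_eContDiffHolderNorm_zero (f t) r)
  have h2 := h1.trans (h t ht)
  rwa [← ofReal_norm, ENNReal.ofReal_le_ofReal_iff hB] at h2

end SupBounds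

/-! ## At most one squiggling cut-off is active at a point -/

section Cutoffs

variable {T τ c₀ : ℝ} {Cη : ℕ → ℕ → ℝ}

/-- **One active cut-off**: by the pairwise disjointness (ii) of the supports of the `η_i`, at a
space–time point `(x, t)` at most one `η_i(x,t)` is nonzero; hence a finite sum `∑_i f_i` of
terms vanishing wherever `η_i(x,t) = 0`, each of norm at most `B ≥ 0`, has norm at most `B`.
[cite: BuckmasterEtAl2018, §5.2 (ii)] -/
theorem CutoffFamily.norm_sum_le {E : Type*} [SeminormedAddCommGroup E]
    (cut : CutoffFamily T τ c₀ Cη) (t : ℝ) (x : UnitAddTorus (Fin 3)) {f : ℕ → E} {B : ℝ}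
    (hB : 0 ≤ B) (hzero : ∀ i, cut.η i t x = 0 → f i = 0) (hbound : ∀ i, ‖f i‖ ≤ B)
    (s : Finset ℕ) :
    ‖∑ i ∈ s, f i‖ ≤ B := by
  classical
  by_cases h : ∃ i₀ ∈ s, cut.η i₀ t x ≠ 0
  · obtain ⟨i₀, hi₀, hne⟩ := h
    have hothers : ∀ i ∈ s, i ≠ i₀ → f i = 0 := by
      intro i _ hi
      refine hzero i ?_
      rcases cut.disjoint i i₀ hi t x with h' | h'
      · exact h'
      · exact absurd h' hne
    rw [Finset.sum_eq_single_of_mem i₀ hi₀ fun i hi hne' => hothers i hi hne']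
    exact hbound i₀
  · push Not at h
    rw [Finset.sum_eq_zero fun i hi => hzero i (h i hi), norm_zero]
    exact hB

end Cutoffs

/-! ## Mikado profiles are bounded on `𝒩 × T³` -/

section MikadoBound

/-- **Uniform bounds for Mikado data**: a family `U(R, ξ)` on `𝕄 × T³` that is jointly smooth
(through the lift `(R, y) ↦ U(R, proj y)`, as the fields of a `BDSV.MikadoDatum` are) is bounded
on `K × T³` for every compact set `K` of matrices — continuity on the compact set `K × [0,1]³`,
every point of `T³` having a representative in the unit cube. [folklore] -/
theorem exists_bound_of_contDiff_mikado
    {U : Matrix (Fin 3) (Fin 3) ℝ → UnitAddTorus (Fin 3) → EuclideanSpace ℝ (Fin 3)}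
    (hU : ContDiff ℝ ∞ fun p : Matrix (Fin 3) (Fin 3) ℝ × EuclideanSpace ℝ (Fin 3) => U p.1 (proj p.2))
    {K : Set (Matrix (Fin 3) (Fin 3) ℝ)} (hK : IsCompact K) :
    ∃ B : ℝ, 0 ≤ B ∧ ∀ R ∈ K, ∀ ξ : UnitAddTorus (Fin 3), ‖U R ξ‖ ≤ B := by
  set S : Set (Matrix (Fin 3) (Fin 3) ℝ × EuclideanSpace ℝ (Fin 3)) := K ×ˢ
    ((WithLp.toLp 2) '' Set.pi Set.univ fun _ : Fin 3 => Icc (0 : ℝ) 1) with hS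
  have hSc : IsCompact S := hK.prod isCompact_toLp_image_pi_Icc
  obtain ⟨B, hB⟩ := hSc.exists_bound_of_continuousOn hU.continuous.continuousOn
  refine ⟨max B 0, le_max_right _ _, fun R hR ξ => ?_⟩
  have hmem : (R, repr ξ) ∈ S := ⟨hR, repr_mem_toLp_image_pi_Icc ξ⟩
  have h := hB _ hmem
  simp only [proj_repr] at h
  exact h.trans (le_max_left _ _)

/-- The potential `V` of a Mikado datum is bounded on `K × T³` for every compact `K`. [folklore] -/
theorem MikadoDatum.exists_bound_V {r : ℝ} (𝔚 : MikadoDatum r) {K : Set (Matrix (Fin 3) (Fin 3) ℝ)}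
    (hK : IsCompact K) : ∃ B : ℝ, 0 ≤ B ∧ ∀ R ∈ K, ∀ ξ : UnitAddTorus (Fin 3), ‖𝔚.V R ξ‖ ≤ B :=
  exists_bound_of_contDiff_mikado 𝔚.smooth_V hK

/-- The profile `W` of a Mikado datum is bounded on `K × T³` for every compact `K`. [folklore] -/
theorem MikadoDatum.exists_bound_W {r : ℝ} (𝔚 : MikadoDatum r) {K : Set (Matrix (Fin 3) (Fin 3) ℝ)}
    (hK : IsCompact K) : ∃ B : ℝ, 0 ≤ B ∧ ∀ R ∈ K, ∀ ξ : UnitAddTorus (Fin 3), ‖𝔚.W R ξ‖ ≤ B :=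
  exists_bound_of_contDiff_mikado 𝔚.smooth_W hK

/-! ## Matrix actions in the elementwise sup norm -/

/-- `‖A v‖ ≤ 9 ‖A‖_∞ ‖v‖` for a real `3 × 3` matrix acting on `ℝ³` (`‖A‖_∞` the elementwise sup
norm): `|(Av)ᵢ| ≤ ∑ⱼ |Aᵢⱼ| |vⱼ| ≤ 3‖A‖_∞‖v‖` and `‖Av‖ ≤ ∑ᵢ |(Av)ᵢ|`. [folklore] -/
theorem norm_toEuclideanLin_le (A : Matrix (Fin 3) (Fin 3) ℝ) (v : EuclideanSpace ℝ (Fin 3)) :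
    ‖Matrix.toEuclideanLin A v‖ ≤ 9 * ‖A‖ * ‖v‖ := by
  have hv : ∀ j, |v j| ≤ ‖v‖ := fun j => abs_apply_le_norm v j
  have hA : ∀ i j, |A i j| ≤ ‖A‖ := fun i j => by
    rw [← Real.norm_eq_abs]
    exact Matrix.norm_entry_le_entrywise_sup_norm A
  have hrow : ∀ i, |Matrix.toEuclideanLin A v i| ≤ 3 * ‖A‖ * ‖v‖ := by
    intro i
    have h : Matrix.toEuclideanLin A v i = ∑ j, A i j * v j := rfl
    rw [h, Fin.sum_univ_three]
    have t : ∀ j, |A i j * v j| ≤ ‖A‖ * ‖v‖ := fun j => by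
      rw [abs_mul]
      exact mul_le_mul (hA i j) (hv j) (abs_nonneg _) (norm_nonneg _)
    calc |A i 0 * v 0 + A i 1 * v 1 + A i 2 * v 2|
        ≤ |A i 0 * v 0| + |A i 1 * v 1| + |A i 2 * v 2| := abs_add_three _ _ _
      _ ≤ 3 * ‖A‖ * ‖v‖ := by linarith [t 0, t 1, t 2]
  calc ‖Matrix.toEuclideanLin A v‖ ≤ ∑ i, |Matrix.toEuclideanLin A v i| := norm_le_sum_abs₃ _
    _ = |Matrix.toEuclideanLin A v 0| + |Matrix.toEuclideanLin A v 1| +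
          |Matrix.toEuclideanLin A v 2| := by rw [Fin.sum_univ_three]
    _ ≤ 9 * ‖A‖ * ‖v‖ := by linarith [hrow 0, hrow 1, hrow 2]

/-- Entries of a product of `3 × 3` matrices: `‖A B‖_∞ ≤ 3 ‖A‖_∞ ‖B‖_∞`. [folklore] -/
theorem norm_matrix_mul_le (A B : Matrix (Fin 3) (Fin 3) ℝ) : ‖A * B‖ ≤ 3 * ‖A‖ * ‖B‖ := by
  have hA : ∀ i j, |A i j| ≤ ‖A‖ := fun i j => by
    rw [← Real.norm_eq_abs]; exact Matrix.norm_entry_le_entrywise_sup_norm A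
  have hB : ∀ i j, |B i j| ≤ ‖B‖ := fun i j => by
    rw [← Real.norm_eq_abs]; exact Matrix.norm_entry_le_entrywise_sup_norm B
  have h9 : 0 ≤ 3 * ‖A‖ * ‖B‖ := by positivity
  rw [Matrix.norm_le_iff h9]
  intro i j
  rw [Matrix.mul_apply, Fin.sum_univ_three, Real.norm_eq_abs]
  have t : ∀ k, |A i k * B k j| ≤ ‖A‖ * ‖B‖ := fun k => by
    rw [abs_mul]; exact mul_le_mul (hA i k) (hB k j) (abs_nonneg _) (norm_nonneg _)
  calc |A i 0 * B 0 j + A i 1 * B 1 j + A i 2 * B 2 j|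
      ≤ |A i 0 * B 0 j| + |A i 1 * B 1 j| + |A i 2 * B 2 j| := abs_add_three _ _ _
    _ ≤ 3 * ‖A‖ * ‖B‖ := by linarith [t 0, t 1, t 2]

end MikadoBound

end BDSV

end Literature.Analysis.FluidPDE
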